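import Summits.HubbardSuperconductivity.HubbardSuperconductivity.Theorems.AnisotropyChordInsertionEntropySheetRung
import Summits.HubbardSuperconductivity.HubbardSuperconductivity.Theorems.AnisotropyChordInsertionEntropySheetCorrelations

/-!
# Route `AnisotropyChord` / H0 rotor rung: `HalfFilledSheetScreening` from the standard outputs of a cluster
# expansion — S4 for the half-filled sheet, `SheetClusterOutputs` / `SheetDecayOutputs ⟹` uniform BEC
# (port of theory seat `hubbard-h0-rotor-theory-1`, Sketch9 Parts N (sheet half) and N′, memo ROTOR-THEORY-9 §135(q)(r))

* homogeneity of the canonical Jastrow–sheet state in the `dens` currency (`dens_sheetSector_const`), `Σ_z ρ_z = N`,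
  and **`ρ_L = ⌊L²/2⌋/L²` exactly** for the half-filled state (`dens_halfSheet_eq`; hence `3/8 ≤ ρ ≤ 1/2`);
* typed targets **T0** `SheetParticleHoleFloor`, **T2** `SheetTruncatedPairDecay`, **T3** `SheetTruncatedTripleDecay`,
  the package `SheetClusterOutputs` and **S4 (PROVED)** `halfFilledSheetScreening_of_cluster :
  SheetClusterOutputs → HalfFilledSheetScreening`, `condensate_of_sheetClusterOutputs`;
* **T0 is automatic (PROVED):** pair decay with amplitude `K ≤ 1/16` gives the particle–hole floor `c₀ = 1/8`
  (`sheetParticleHoleFloor_of_pairDecay`); the sharpened package `SheetDecayOutputs` (two decay statements) and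
  `condensate_of_sheetDecayOutputs` (uniform BEC `e^{−C/2}/4 ≤ n₀/|Λ|`, even `L ≥ 2`, `0 < β ≤ β₀`).
-/

set_option linter.dupNamespace false

noncomputable section

open Finset
open Literature.Probability.LatticeModels

namespace Summit.HubbardSuperconductivity.HubbardSuperconductivity.Theorems.AnisotropyChord.InsertionEntropy

section SheetCluster

variable {V : Type} [Fintype V] [DecidableEq V]

/-- `wsum a n_x = siteDensity a x`. [folklore] -/
theorem wsum_occ_eq_siteDensity (a : (V → Fin 2) → ℝ) (x : V) :
    wsum a (fun σ => occ σ x) = siteDensity a x := by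
  unfold wsum siteDensity occ
  refine Finset.sum_congr rfl fun σ _ => ?_
  by_cases h : σ x = 0 <;> simp [h]

/-- `ρ_x = siteDensity a x / Z` in the `dens` currency. [folklore] -/
theorem dens_eq_siteDensity_div (a : (V → Fin 2) → ℝ) (x : V) : dens a x = siteDensity a x / wnorm a := by
  unfold dens wmean; rw [wsum_occ_eq_siteDensity]

/-- `Z = 1` for the canonical Jastrow state of a non-empty sector. [folklore] -/
theorem wnorm_jastrowSectorAmp (w : V → V → ℝ) (N : ℕ) (hZ : 0 < jastrowSectorWeight w N) :
    wnorm (jastrowSectorAmp w N) = 1 := by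
  unfold wnorm; exact sum_jastrowSectorAmp_sq w N hZ

/-- In an `N`-sector canonical state, `Σ_z ρ_z = N`. (theory seat Sketch9 Part N′ `sum_dens_sectorAmp`) [folklore] -/
theorem sum_dens_jastrowSectorAmp (w : V → V → ℝ) (N : ℕ) (hZ : 0 < jastrowSectorWeight w N) :
    ∑ z, dens (jastrowSectorAmp w N) z = N := by
  rw [sum_dens_eq]
  unfold wmean
  rw [wnorm_jastrowSectorAmp w N hZ, div_one]
  unfold wsum
  calc ∑ σ, jastrowSectorAmp w N σ ^ 2 * ∑ z, occ σ z
      = ∑ σ, jastrowSectorAmp w N σ ^ 2 * (N : ℝ) := by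
        refine Finset.sum_congr rfl fun σ _ => ?_
        by_cases h : jastrowSectorAmp w N σ = 0
        · rw [h]; ring
        · rw [sum_occ_eq_particleCount, particleCount_eq_of_jastrowSectorAmp_ne_zero w N σ h]
    _ = (N : ℝ) := by rw [← Finset.sum_mul, sum_jastrowSectorAmp_sq w N hZ, one_mul]

/-- **Homogeneity (PROVED):** the one-point density of the canonical Jastrow–sheet state is the same at every site.
(theory seat Sketch9 Part N `dens_sheetSector_const`) [folklore] -/
theorem dens_sheetSector_const (L : ℕ) [NeZero L] (β c : ℝ) (N : ℕ) (z x : TorusSite 2 L) :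
    dens (jastrowSectorAmp (sheetKernel L β c) N) z = dens (jastrowSectorAmp (sheetKernel L β c) N) x := by
  rw [dens_eq_siteDensity_div, dens_eq_siteDensity_div, siteDensity_sheetSector_eq L β c N z,
    siteDensity_sheetSector_eq L β c N x]

/-- `4 ≤ L²`, `1 ≤ ⌊L²/2⌋`, `⌊L²/2⌋ + 1 ≤ |(ℤ/L)²|` for `L ≥ 2`. [folklore] -/
theorem halfFilling_side (L : ℕ) [NeZero L] (hL : 2 ≤ L) :
    1 ≤ L ^ 2 / 2 ∧ L ^ 2 / 2 + 1 ≤ Fintype.card (TorusSite 2 L) ∧ L ^ 2 / 2 ≤ Fintype.card (TorusSite 2 L) := by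
  have hcardN : Fintype.card (TorusSite 2 L) = L ^ 2 := by rw [Fintype.card_fun, ZMod.card, Fintype.card_fin]
  have hsq : 4 ≤ L ^ 2 := by nlinarith
  rw [hcardN]; omega

/-- The half-filled sector is non-empty (`L ≥ 2`). [folklore] -/
theorem jastrowSectorWeight_halfSheet_pos (L : ℕ) [NeZero L] (β : ℝ) (hL : 2 ≤ L) :
    0 < jastrowSectorWeight (sheetKernel L β 0) (L ^ 2 / 2) :=
  jastrowSectorWeight_pos_of_le _ _ (halfFilling_side L hL).2.2

/-- `Z = 1 ≠ 0` for the half-filled state (`L ≥ 2`). [folklore] -/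
theorem wnorm_halfSheetAmp_ne_zero (L : ℕ) [NeZero L] (β : ℝ) (hL : 2 ≤ L) : wnorm (halfSheetAmp L β) ≠ 0 := by
  unfold halfSheetAmp
  rw [wnorm_jastrowSectorAmp _ _ (jastrowSectorWeight_halfSheet_pos L β hL)]
  exact one_ne_zero

/-- Every ordered pair admits a template in the half-filled state (`L ≥ 2`). [folklore] -/
theorem pairMass_halfSheetAmp_pos (L : ℕ) [NeZero L] (β : ℝ) (hL : 2 ≤ L) (x y : TorusSite 2 L) (hxy : x ≠ y) :
    0 < pairMass (halfSheetAmp L β) x y := by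
  obtain ⟨h1, h2, -⟩ := halfFilling_side L hL
  exact pairMass_jastrowSectorAmp_pos _ _ h1 h2 x y hxy

/-- Homogeneity of the half-filled state. [folklore] -/
theorem dens_halfSheet_const (L : ℕ) [NeZero L] (β : ℝ) (z x : TorusSite 2 L) :
    dens (halfSheetAmp L β) z = dens (halfSheetAmp L β) x :=
  dens_sheetSector_const L β 0 (L ^ 2 / 2) z x

/-- **`ρ_L = ⌊L²/2⌋/L²` (PROVED)** for the half-filled canonical sheet state, `L ≥ 2`.
(theory seat Sketch9 Part N′ `dens_halfSheet_eq`) [folklore] -/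
theorem dens_halfSheet_eq (L : ℕ) [NeZero L] (β : ℝ) (hL : 2 ≤ L) (x : TorusSite 2 L) :
    dens (halfSheetAmp L β) x = ((L ^ 2 / 2 : ℕ) : ℝ) / (L : ℝ) ^ 2 := by
  have hsum : ∑ z, dens (halfSheetAmp L β) z = ((L ^ 2 / 2 : ℕ) : ℝ) :=
    sum_dens_jastrowSectorAmp _ _ (jastrowSectorWeight_halfSheet_pos L β hL)
  have hconst : ∑ z, dens (halfSheetAmp L β) z = ∑ _z : TorusSite 2 L, dens (halfSheetAmp L β) x :=
    Finset.sum_congr rfl fun z _ => dens_halfSheet_const L β z x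
  have hcard : (Fintype.card (TorusSite 2 L) : ℝ) = (L : ℝ) ^ 2 := by
    rw [Fintype.card_fun, ZMod.card, Fintype.card_fin]; push_cast; ring
  rw [hconst, Finset.sum_const, Finset.card_univ, nsmul_eq_mul, hcard] at hsum
  have hL0 : (0 : ℝ) < (L : ℝ) ^ 2 := by
    have : (0 : ℝ) < (L : ℝ) := by exact_mod_cast (by omega : 0 < L)
    positivity
  field_simp
  linarith

/-- `3/8 ≤ ρ_L ≤ 1/2` for the half-filled state, `L ≥ 2`. (theory seat Sketch9 Part N′) [folklore] -/
theorem dens_halfSheet_bounds (L : ℕ) [NeZero L] (β : ℝ) (hL : 2 ≤ L) (x : TorusSite 2 L) :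
    3 / 8 ≤ dens (halfSheetAmp L β) x ∧ dens (halfSheetAmp L β) x ≤ 1 / 2 := by
  rw [dens_halfSheet_eq L β hL x]
  have hL0 : (0 : ℝ) < (L : ℝ) ^ 2 := by
    have : (0 : ℝ) < (L : ℝ) := by exact_mod_cast (by omega : 0 < L)
    positivity
  have hsq : 4 ≤ L ^ 2 := by nlinarith
  have h1 : L ^ 2 - 1 ≤ 2 * (L ^ 2 / 2) := by omega
  have h2 : 2 * (L ^ 2 / 2) ≤ L ^ 2 := by omega
  have h1' : ((L : ℝ) ^ 2 - 1) ≤ 2 * ((L ^ 2 / 2 : ℕ) : ℝ) := by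
    have : ((L ^ 2 - 1 : ℕ) : ℝ) ≤ ((2 * (L ^ 2 / 2) : ℕ) : ℝ) := by exact_mod_cast h1
    rw [Nat.cast_sub (by omega), Nat.cast_pow] at this; push_cast at this; linarith
  have h2' : 2 * ((L ^ 2 / 2 : ℕ) : ℝ) ≤ (L : ℝ) ^ 2 := by
    have : ((2 * (L ^ 2 / 2) : ℕ) : ℝ) ≤ ((L ^ 2 : ℕ) : ℝ) := by exact_mod_cast h2
    push_cast at this; linarith
  have hL4 : (4 : ℝ) ≤ (L : ℝ) ^ 2 := by exact_mod_cast hsq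
  constructor
  · rw [le_div_iff₀ hL0]; nlinarith
  · rw [div_le_iff₀ hL0]; linarith

/-- **T0 `SheetParticleHoleFloor β c₀` (typed target):** particle–hole floor `μ(n_x(1−n_y)) ≥ c₀` for all `x ≠ y`,
`L ≥ 2`, in the half-filled sheet gas at coupling `β` (`≈ ¼` at small `β`; automatic from T2, see
`sheetParticleHoleFloor_of_pairDecay`).
[conjecture: theory seat hubbard-h0-rotor-theory-1, cycle 9, 2026-08-28 — Sketch9 Part N, memo ROTOR-THEORY-9 §135(q) (T0; typed target)] -/
def SheetParticleHoleFloor (β c₀ : ℝ) : Prop :=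
  ∀ (L : ℕ) [NeZero L], 2 ≤ L → ∀ x y : TorusSite 2 L, x ≠ y → c₀ ≤ probPH (halfSheetAmp L β) x y

/-- **T2 `SheetTruncatedPairDecay β K ε` (typed target, OPEN):** `|μ(n_u n_v) − ρ_u ρ_v| ≤ K (1 + d(u−v))^{−(1+ε)}`
for the half-filled sheet gas (Debye–Hückel predicts `(C/β)(1+r)^{−2}` uniformly, `1/(π²βr³)` in the bulk).
[conjecture: theory seat hubbard-h0-rotor-theory-1, cycle 9, 2026-08-28 — Sketch9 Part N, memo ROTOR-THEORY-9 §135(q) (T2; OPEN)] -/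
def SheetTruncatedPairDecay (β K ε : ℝ) : Prop :=
  ∀ (L : ℕ) [NeZero L], 2 ≤ L → ∀ u v : TorusSite 2 L, u ≠ v →
    |corr2 (halfSheetAmp L β) u v| ≤ K * latWeight L (1 + ε) (u - v)

/-- **T3 `SheetTruncatedTripleDecay β K ε` (typed target, OPEN):** decay of the Ursell three-point function of the
half-filled sheet gas, `|u₃(z,x,y)| ≤ K((1+d(z−x))^{−(1+ε)} + (1+d(z−y))^{−(1+ε)})`.
[conjecture: theory seat hubbard-h0-rotor-theory-1, cycle 9, 2026-08-28 — Sketch9 Part N, memo ROTOR-THEORY-9 §135(q) (T3; OPEN)] -/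
def SheetTruncatedTripleDecay (β K ε : ℝ) : Prop :=
  ∀ (L : ℕ) [NeZero L], 2 ≤ L → ∀ x y z : TorusSite 2 L, x ≠ y → z ≠ x → z ≠ y →
    |ucorr3 (halfSheetAmp L β) z x y| ≤ K * (latWeight L (1 + ε) (z - x) + latWeight L (1 + ε) (z - y))

/-- **`SheetClusterOutputs` (the cluster-expansion target as three standard outputs; OPEN):** for small `β` the
canonical half-filled sheet gas has a particle–hole floor and `(1+ε)`-decay of the truncated pair function and of
the Ursell three-point function.
[conjecture: theory seat hubbard-h0-rotor-theory-1, cycle 9, 2026-08-28 — Sketch9 Part N, memo ROTOR-THEORY-9 §135(q) (OPEN; Brydges 1978 / Imbrie 1983 technology)] -/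
def SheetClusterOutputs : Prop :=
  ∃ β₀ : ℝ, 0 < β₀ ∧ ∀ β : ℝ, 0 < β → β ≤ β₀ → ∃ K ε c₀ : ℝ, 0 < ε ∧ 0 < c₀ ∧
    SheetParticleHoleFloor β c₀ ∧ SheetTruncatedPairDecay β K ε ∧ SheetTruncatedTripleDecay β K ε

/-- On `(ℤ/L)²`, two distinct sites force `L ≥ 2`. [folklore] -/
theorem two_le_of_ne (L : ℕ) [NeZero L] (x y : TorusSite 2 L) (hxy : x ≠ y) : 2 ≤ L := by
  by_contra hlt
  have hL1 : L = 1 := by have := NeZero.ne L; omega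
  subst hL1
  have : Fintype.card (TorusSite 2 1) = 1 := by rw [Fintype.card_fun, ZMod.card, Fintype.card_fin]; norm_num
  have hs : Subsingleton (TorusSite 2 1) := Fintype.card_le_one_iff_subsingleton.mp this.le
  exact hxy (Subsingleton.elim x y)

/-- **S4 (PROVED): `SheetClusterOutputs → HalfFilledSheetScreening`.**  The S4 identity/bound with `m = ρ`,
homogeneity, and the trivial sites `z ∈ {x, y}`. (theory seat Sketch9 Part N `halfFilledSheetScreening_of_cluster`) [folklore] -/
theorem halfFilledSheetScreening_of_cluster (h : SheetClusterOutputs) : HalfFilledSheetScreening := by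
  obtain ⟨β₀, hβ₀, h⟩ := h
  refine ⟨β₀, hβ₀, fun β hβ hβ' => ?_⟩
  obtain ⟨K, ε, c₀, hε, hc₀, hT0, hT2, hT3⟩ := h β hβ hβ'
  refine ⟨max 1 (2 * K / c₀), ε, hε, fun L _ x y hxy => ?_⟩
  have hL : 2 ≤ L := two_le_of_ne L x y hxy
  change ∃ m : ℝ, ∀ z : TorusSite 2 L, |condOcc (halfSheetAmp L β) x y z - m|
      ≤ max 1 (2 * K / c₀) * (latWeight L (1 + ε) (z - x) + latWeight L (1 + ε) (z - y))
  have hpm : pairMass (halfSheetAmp L β) x y ≠ 0 := (pairMass_halfSheetAmp_pos L β hL x y hxy).ne'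
  have hZ : wnorm (halfSheetAmp L β) ≠ 0 := wnorm_halfSheetAmp_ne_zero L β hL
  have hC2 : 2 * K / c₀ ≤ max 1 (2 * K / c₀) := le_max_right _ _
  refine ⟨dens (halfSheetAmp L β) x, fun z => ?_⟩
  by_cases hzx : z = x
  · subst hzx
    rw [condOcc_self_left, zero_sub, abs_neg, abs_of_nonneg (dens_nonneg (halfSheetAmp L β) z), sub_self,
      latWeight_zero]
    calc dens (halfSheetAmp L β) z ≤ 1 := dens_le_one (halfSheetAmp L β) z
      _ ≤ max 1 (2 * K / c₀) * (1 + latWeight L (1 + ε) (z - y)) := by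
          nlinarith [latWeight_nonneg L (1 + ε) (z - y), le_max_left (1 : ℝ) (2 * K / c₀)]
  by_cases hzy : z = y
  · subst hzy
    rw [condOcc_self_right, zero_sub, abs_neg, dens_halfSheet_const L β x z,
      abs_of_nonneg (dens_nonneg (halfSheetAmp L β) z), sub_self, latWeight_zero]
    calc dens (halfSheetAmp L β) z ≤ 1 := dens_le_one (halfSheetAmp L β) z
      _ ≤ max 1 (2 * K / c₀) * (latWeight L (1 + ε) (z - x) + 1) := by
          nlinarith [latWeight_nonneg L (1 + ε) (z - x), le_max_left (1 : ℝ) (2 * K / c₀)]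
  · rw [dens_halfSheet_const L β x z]
    have key := abs_condOcc_sub_dens_le (halfSheetAmp L β) x y z hxy hzx hZ hpm K (latWeight L (1 + ε) (z - x))
      (latWeight L (1 + ε) (z - y)) c₀ hc₀ (hT0 L hL x y hxy) (hT2 L hL z x hzx) (hT2 L hL z y hzy)
      (hT3 L hL x y z hxy hzx hzy)
    exact key.trans (mul_le_mul_of_nonneg_right hC2 (add_nonneg (latWeight_nonneg L _ _) (latWeight_nonneg L _ _)))

/-- **END-TO-END (PROVED): cluster outputs ⟹ uniform BEC of the half-filled Jastrow–sheet RK state**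
(`e^{−C/2}/4 ≤ n₀/|Λ|`, even `L ≥ 2`, `0 < β ≤ β₀`). (theory seat Sketch9 Part N `condensate_of_sheetClusterOutputs`) [folklore] -/
theorem condensate_of_sheetClusterOutputs (h : SheetClusterOutputs) :
    ∃ β₀ : ℝ, 0 < β₀ ∧ ∀ β : ℝ, 0 < β → β ≤ β₀ → ∃ C : ℝ, ∀ L : ℕ, ∀ [NeZero L], 2 ≤ L → Even L →
      Real.exp (-C / 2) / 4 ≤ condensateDensity (halfSheetAmp L β) :=
  condensate_of_halfFilledSheetScreening_even (halfFilledSheetScreening_of_cluster h)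

/-! ### Part N′ — T0 is automatic from small-amplitude pair decay -/

/-- `(1 + d(v))^{−q} ≤ 1` for `q ≥ 0`. (theory seat Sketch9 Part N′) [folklore] -/
theorem latWeight_le_one (L : ℕ) [NeZero L] {q : ℝ} (hq : 0 ≤ q) (v : TorusSite 2 L) : latWeight L q v ≤ 1 := by
  have h := latWeight_le_of_dist_le L hq (u := 0) (v := v)
    (by rw [torusNorm_zero_eq, mul_zero]; exact latDist_nonneg L v)
  rwa [latWeight_zero] at h

/-- **T0 from T2 (PROVED):** pair decay with amplitude `K ≤ 1/16` gives the particle–hole floor `c₀ = 1/8`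
(`μ(n_x(1−n_y)) = ρ(1−ρ) − c(x,y) ≥ (3/8)(1/2) − 1/16 = 1/8`). (theory seat Sketch9 Part N′) [folklore] -/
theorem sheetParticleHoleFloor_of_pairDecay (β K ε : ℝ) (hε : 0 ≤ ε) (hK : K ≤ 1 / 16)
    (hT2 : SheetTruncatedPairDecay β K ε) : SheetParticleHoleFloor β (1 / 8) := by
  intro L _ hL x y hxy
  rw [probPH_eq_dens_sub]
  obtain ⟨hx0, hx1⟩ := dens_halfSheet_bounds L β hL x
  obtain ⟨hy0, hy1⟩ := dens_halfSheet_bounds L β hL y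
  have hc : corr2 (halfSheetAmp L β) x y ≤ 1 / 16 := by
    calc corr2 (halfSheetAmp L β) x y ≤ |corr2 (halfSheetAmp L β) x y| := le_abs_self _
      _ ≤ K * latWeight L (1 + ε) (x - y) := hT2 L hL x y hxy
      _ ≤ 1 / 16 := by
          have hw0 := latWeight_nonneg L (1 + ε) (x - y)
          have hw1 := latWeight_le_one L (by linarith : 0 ≤ 1 + ε) (x - y)
          rcases le_or_gt 0 K with hK0 | hK0
          · nlinarith [mul_le_mul_of_nonneg_left hw1 hK0]
          · nlinarith [mul_nonneg hw0 (by linarith : 0 ≤ -K)]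
  nlinarith

/-- **`SheetDecayOutputs` (the sharpened target — TWO decay statements; OPEN):** for small `β`, `(1+ε)`-decay of the
truncated pair function with amplitude `K ≤ 1/16` and of the Ursell three-point function of the canonical
half-filled sheet gas.
[conjecture: theory seat hubbard-h0-rotor-theory-1, cycle 9, 2026-08-28 — Sketch9 Part N′, memo ROTOR-THEORY-9 §135(r) (OPEN)] -/
def SheetDecayOutputs : Prop :=
  ∃ β₀ : ℝ, 0 < β₀ ∧ ∀ β : ℝ, 0 < β → β ≤ β₀ → ∃ K ε : ℝ, 0 < ε ∧ K ≤ 1 / 16 ∧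
    SheetTruncatedPairDecay β K ε ∧ SheetTruncatedTripleDecay β K ε

/-- `SheetDecayOutputs → SheetClusterOutputs` (T0 with `c₀ = 1/8`). (theory seat Sketch9 Part N′) [folklore] -/
theorem sheetClusterOutputs_of_decay (h : SheetDecayOutputs) : SheetClusterOutputs := by
  obtain ⟨β₀, hβ₀, h⟩ := h
  refine ⟨β₀, hβ₀, fun β hβ hβ' => ?_⟩
  obtain ⟨K, ε, hε, hK, hT2, hT3⟩ := h β hβ hβ'
  exact ⟨K, ε, 1 / 8, hε, by norm_num, sheetParticleHoleFloor_of_pairDecay β K ε hε.le hK hT2, hT2, hT3⟩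

/-- **END-TO-END from the two decay statements (PROVED):** `SheetDecayOutputs ⟹ e^{−C/2}/4 ≤ n₀/|Λ|` for the
half-filled Jastrow–sheet RK state, even `L ≥ 2`, `0 < β ≤ β₀`. (theory seat Sketch9 Part N′) [folklore] -/
theorem condensate_of_sheetDecayOutputs (h : SheetDecayOutputs) :
    ∃ β₀ : ℝ, 0 < β₀ ∧ ∀ β : ℝ, 0 < β → β ≤ β₀ → ∃ C : ℝ, ∀ L : ℕ, ∀ [NeZero L], 2 ≤ L → Even L →
      Real.exp (-C / 2) / 4 ≤ condensateDensity (halfSheetAmp L β) :=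
  condensate_of_sheetClusterOutputs (sheetClusterOutputs_of_decay h)

end SheetCluster

end Summit.HubbardSuperconductivity.HubbardSuperconductivity.Theorems.AnisotropyChord.InsertionEntropy
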